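import Mathlib
import HarnessLib
import Literature.Combinatorics.Additive.KempermanMinimalCounterexample

/-!
# Kemperman's structure theorem (Boothby–DeVos–Montejano Theorem 4.5): the quotient step, the one-step
# theorem, the printed chain form, and the critical-pair entry point

[cite: BoothbyDevosMontejano2013, Thm 4.5; §8 (Claim 6)] [cite: Grynkiewicz2013, Ch. 9]
[tag: critical-pair] [tag: inverse-theorem]

This file completes the formalization, for FINITE abelian groups, of the Kemperman structure
theorem as organised by Boothby, DeVos and Montejano (arXiv:1301.0095): §§2–3, 5–6 are in
`CriticalTrios.lean`, §4 in `KempermanStructures.lean`, §7 in `KempermanNearSequences.lean`, §8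
(Claims 7–12 and the final step) in `KempermanMinimalCounterexample.lean`.  Here:

* **Claim 6 of §8 (the quotient step).**  "The group `H = stab(A) = stab(B) = stab(C)` is trivial.
  Otherwise we obtain a smaller counterexample by passing to the quotient group `G/H` and the trio
  `(φ(A), φ(B), φ(C))`."  Formalized as a transport tool kit along a surjective homomorphism
  `π : G →+ Q` whose kernel is the subgroup carrier `K` (`hker : ∀ x, π x = 0 ↔ x ∈ K`), for
  `K`-periodic finsets (`X + K = X`): periodicity is preserved by `+`, translation, `−`, `ᶜ`, `∩`, `∪`,
  `∖`, `third`, `rseq` (`periodic_*`); images commute with these operations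
  (`image_inter/sdiff/compl/third_of_periodic`, `image_rseq`, Mathlib's `image_add`,
  `image_vadd_distrib`, `image_neg`); periodic sets with equal images are equal (`eq_of_image_eq`);
  `|X| = |π X| · |K|` (`card_of_periodic`, `card_univ_eq_mul`, `trioDeficiency_eq_mul`); trios
  (`isTrio_image_iff`); pullbacks `pullback π S` of finsets of `Q` (`image_pullback`,
  `eq_pullback_image`, `isSubgroupCarrier_pullback/_image`, `subset_coset_pullback_iff`,
  `addStab_eq_pullback`, `isCyclicQuotGen_pullback`); and the LIFTS: a triple similar in `Q` to the
  image of a periodic triple is the image of a periodic triple similar to it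
  (`exists_lift_of_similar`), the four normal-position structures lift
  (`isPureBeatAt_lift`, `isPureChordAt_lift`, `isImpureBeatAt_lift`, `isImpureChordAt_lift`), hence
  so do the four similarity-closed ones (`structure_lift`) — all PROVED.
* **Theorem 4.5, one step** (`kemperman_structure_step`): every maximal nontrivial critical trio
  `(A,B,C)` of a finite abelian group (`IsMaximalTrio A B C`, `0 < trioDeficiency A B C`, members
  nonempty) is a pure beat, a pure chord, an impure beat or an impure chord relative to some proper
  subgroup carrier `H` — PROVED, by the induction of §8: on `|G|` over all finite abelian groups
  (criterion 1; the quotient `G ⧸ stab(A)` via `QuotientAddGroup.mk'` and the lifts above) and on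
  `|G| − max(|A|,|B|,|C|)` (criterion 2), the sorted trivial-stabiliser case being
  `kemperman_step_of_addStab_eq_singleton`; `exists_similar_sorted` arranges `|A| ≤ |B| ≤ |C|`.

* **Theorem 4.5 as printed** (`kemperman_structure_chain`): "there exists a sequence of trios
  `Υ₁, …, Υ_m` in respective subgroups `G₁ > G₂ > ⋯ > G_m` satisfying (1) `Υ_i` is an impure beat or
  an impure chord with continuation `Υ_{i+1}` for `1 ≤ i ≤ m − 1`, and (2) `Υ_m` is either a pure beat
  or a pure chord" — PROVED as the inductive predicate `KempermanChain A B C` (constructors `pure`,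
  `impureBeat`, `impureChord`; the continuation `(A₀, B₀ ∩ H, C₀ ∩ H)` resp. `(A₀ ∩ H, B₀ ∩ H, C₀ ∩ H)`
  of Definitions 4.3/4.4 is transported to the group `↥H` by `toSub`), by iterating
  `kemperman_structure_step` on the continuations (`IsImpureBeat.exists_continuation`,
  `IsImpureChord.exists_continuation` of `KempermanStructures.lean`: maximal nontrivial critical
  trios IN `H` with the same deficiency; transport lemmas `isTrio_toSub_iff`, `isMaximalTrio_toSub`,
  `trioDeficiency_toSub`, `card_toSub`) and induction on `|G|`.

* **Entry point for critical pairs** (`kemperman_critical_pair`): for `A, B ≠ ∅` with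
  `|A + B| < |A| + |B|` and `A + B ≠ G`, the hulls `A* = A + stab(A+B) ⊇ A`, `B* = B + stab(A+B) ⊇ B`
  (`A* + B* = A + B`; Proposition 2.2 / Theorem 3.5 of `CriticalTrios.lean`) form with
  `\overline{−(A+B)}` a maximal nontrivial critical trio, which is therefore a pure beat, pure chord,
  impure beat or impure chord relative to a proper subgroup — PROVED.

Infinite abelian groups (where the paper's criterion 3 enters) are outside the finite setting of
these files.  Everything here is PROVED (0 named facts).

## References
* T. Boothby, M. DeVos, A. Montejano, *A new proof of Kemperman's theorem*, arXiv:1301.0095 (2013);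
  INTEGERS 15 (2015) #A5 — Theorem 4.5 and §8, held `paper:arxiv-1301.0095`, chunks p0006,
  p0011–p0012 read 2026-08-28 [cite: BoothbyDevosMontejano2013, Thm 4.5; §8 Claim 6].
* J. H. B. Kemperman, *On small sumsets in an abelian group*, Acta Math. 103 (1960) 63–88 — the
  original structure theorem [cite: Kemperman1960].
* D. J. Grynkiewicz, *Structural Additive Theory*, Springer (2013), Ch. 9 (KST)
  [cite: Grynkiewicz2013, Ch. 9].
-/

namespace Literature.Combinatorics.Additive

open Finset Grynkiewicz
open scoped Pointwise

/-! ## Transport along a surjective homomorphism with kernel carrier `K` -/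

section Transport

variable {G Q : Type*} [AddCommGroup G] [DecidableEq G] [AddCommGroup Q] [DecidableEq Q]
variable {π : G →+ Q} {K X Y Z H S : Finset G} {g x : G}

omit [DecidableEq G] [DecidableEq Q] in
/-- Kernel membership as a finset condition: `π x = π y ↔ x − y ∈ K`.
[cite: BoothbyDevosMontejano2013, §8 (Claim 6)] -/
theorem apply_eq_iff_sub_mem (hker : ∀ x : G, π x = 0 ↔ x ∈ K) {x y : G} :
    π x = π y ↔ x - y ∈ K := by
  rw [← hker, map_sub, sub_eq_zero]

/-- For a `K`-periodic set, membership is detected in the quotient.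
[cite: BoothbyDevosMontejano2013, §8 (Claim 6)] -/
theorem mem_iff_apply_mem_image (hker : ∀ x : G, π x = 0 ↔ x ∈ K) (hX : X + K = X) :
    x ∈ X ↔ π x ∈ X.image π := by
  refine ⟨fun h => mem_image_of_mem _ h, fun h => ?_⟩
  obtain ⟨x', hx', he⟩ := mem_image.1 h
  have hk : x - x' ∈ K := (apply_eq_iff_sub_mem hker).1 he.symm
  rw [← hX]
  exact mem_add.2 ⟨x', hx', x - x', hk, by abel⟩

/-- `K`-periodic sets with the same image are equal. [cite: BoothbyDevosMontejano2013, §8 (Claim 6)] -/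
theorem eq_of_image_eq (hker : ∀ x : G, π x = 0 ↔ x ∈ K) (hX : X + K = X) (hY : Y + K = Y)
    (h : X.image π = Y.image π) : X = Y := by
  ext x
  rw [mem_iff_apply_mem_image hker hX, mem_iff_apply_mem_image hker hY, h]

omit [DecidableEq G] [DecidableEq Q] in
/-- `0 ∈ K`. [cite: BoothbyDevosMontejano2013, §8 (Claim 6)] -/
theorem zero_mem_ker (hker : ∀ x : G, π x = 0 ↔ x ∈ K) : (0 : G) ∈ K := (hker 0).1 (map_zero π)

omit [DecidableEq G] [DecidableEq Q] in
/-- `K` is a subgroup carrier. [cite: BoothbyDevosMontejano2013, §8 (Claim 6)] -/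
theorem isSubgroupCarrier_ker (hker : ∀ x : G, π x = 0 ↔ x ∈ K) : IsSubgroupCarrier K := by
  refine ⟨zero_mem_ker hker, fun x hx y hy => ?_⟩
  rw [← hker] at hx hy ⊢
  rw [map_sub, hx, hy, sub_zero]

/-! ### Periodicity is preserved -/

omit [DecidableEq Q] in
/-- [cite: BoothbyDevosMontejano2013, §8 (Claim 6)] -/
theorem periodic_add (hX : X + K = X) (Y : Finset G) : (X + Y) + K = X + Y := by
  rw [add_right_comm, hX]

omit [DecidableEq Q] in
/-- [cite: BoothbyDevosMontejano2013, §8 (Claim 6)] -/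
theorem periodic_add_left (hY : Y + K = Y) (X : Finset G) : (X + Y) + K = X + Y := by
  rw [add_assoc, hY]

omit [DecidableEq Q] in
/-- [cite: BoothbyDevosMontejano2013, §8 (Claim 6)] -/
theorem periodic_vadd (hX : X + K = X) (g : G) : (g +ᵥ X) + K = g +ᵥ X := by
  rw [add_comm (g +ᵥ X) K, Grynkiewicz.add_vadd_finset K X g, add_comm K X, hX]

/-- [cite: BoothbyDevosMontejano2013, §8 (Claim 6)] -/
theorem periodic_neg (hK : IsSubgroupCarrier K) (hX : X + K = X) : (-X) + K = -X := by
  have : (-X) + K = -(X + K) := by rw [neg_add_rev, add_comm, hK.neg_eq]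
  rw [this, hX]

/-- Membership characterisation of periodicity. [cite: BoothbyDevosMontejano2013, §8 (Claim 6)] -/
theorem periodic_iff (hK : IsSubgroupCarrier K) : X + K = X ↔ ∀ x ∈ X, ∀ k ∈ K, x + k ∈ X := by
  refine ⟨fun h x hx k hk => by rw [← h]; exact add_mem_add hx hk, fun h => ?_⟩
  refine Subset.antisymm ?_ (hK.subset_add X)
  intro y hy
  obtain ⟨x, hx, k, hk, rfl⟩ := mem_add.1 hy
  exact h x hx k hk

/-- [cite: BoothbyDevosMontejano2013, §8 (Claim 6)] -/
theorem periodic_compl [Fintype G] (hK : IsSubgroupCarrier K) (hX : X + K = X) : Xᶜ + K = Xᶜ := by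
  rw [periodic_iff hK]
  intro x hx k hk
  rw [mem_compl] at hx ⊢
  intro h
  apply hx
  have := (periodic_iff hK).1 hX (x + k) h (-k) (hK.neg_mem hk)
  rwa [add_neg_cancel_right] at this

/-- [cite: BoothbyDevosMontejano2013, §8 (Claim 6)] -/
theorem periodic_inter (hK : IsSubgroupCarrier K) (hX : X + K = X) (hY : Y + K = Y) :
    (X ∩ Y) + K = X ∩ Y := by
  rw [periodic_iff hK] at hX hY ⊢
  intro x hx k hk
  rw [mem_inter] at hx ⊢
  exact ⟨hX x hx.1 k hk, hY x hx.2 k hk⟩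

omit [DecidableEq Q] in
/-- [cite: BoothbyDevosMontejano2013, §8 (Claim 6)] -/
theorem periodic_union (hX : X + K = X) (hY : Y + K = Y) : (X ∪ Y) + K = X ∪ Y := by
  rw [union_add, hX, hY]

/-- [cite: BoothbyDevosMontejano2013, §8 (Claim 6)] -/
theorem periodic_sdiff (hK : IsSubgroupCarrier K) (hX : X + K = X) (hY : Y + K = Y) :
    (X \ Y) + K = X \ Y := by
  rw [periodic_iff hK] at hX ⊢
  intro x hx k hk
  rw [mem_sdiff] at hx ⊢
  refine ⟨hX x hx.1 k hk, fun h => hx.2 ?_⟩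
  have := (periodic_iff hK).1 hY (x + k) h (-k) (hK.neg_mem hk)
  rwa [add_neg_cancel_right] at this

/-- [cite: BoothbyDevosMontejano2013, §8 (Claim 6)] -/
theorem periodic_third [Fintype G] (hK : IsSubgroupCarrier K) (hX : X + K = X) (Y : Finset G) :
    third X Y + K = third X Y := by
  rw [third]; exact periodic_compl hK (periodic_neg hK (periodic_add hX Y))

omit [DecidableEq Q] in
/-- A subgroup carrier containing `K ∋ 0` is `K`-periodic. [cite: BoothbyDevosMontejano2013, §8 (Claim 6)] -/
theorem periodic_of_subset (hH : IsSubgroupCarrier H) (hK0 : (0 : G) ∈ K) (hKH : K ⊆ H) :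
    H + K = H :=
  Subset.antisymm (fun y hy => by
    obtain ⟨h, hh, k, hk, rfl⟩ := mem_add.1 hy; exact hH.add_mem hh (hKH hk))
    fun h hh => mem_add.2 ⟨h, hh, 0, hK0, add_zero h⟩

omit [DecidableEq Q] in
/-- `rseq` one step longer. [cite: BoothbyDevosMontejano2013, §4] -/
theorem rseq_succ' (H : Finset G) (r a : G) (n : ℕ) :
    rseq H r a (n + 1) = ((a + n • r) +ᵥ H) ∪ rseq H r a n := by
  rw [rseq_def, rseq_def, Finset.range_add_one, biUnion_insert]

omit [DecidableEq Q] in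
/-- `R`-sequences over a `K`-periodic `H` are `K`-periodic. [cite: BoothbyDevosMontejano2013, §8 (Claim 6)] -/
theorem periodic_rseq (hH : H + K = H) (r a : G) (n : ℕ) : rseq H r a n + K = rseq H r a n := by
  induction n with
  | zero => rw [rseq_zero]; exact empty_add K
  | succ n ih => rw [rseq_succ', union_add, ih, periodic_vadd hH]

/-! ### Images -/

/-- [cite: BoothbyDevosMontejano2013, §8 (Claim 6)] -/
theorem image_inter_of_periodic (hker : ∀ x : G, π x = 0 ↔ x ∈ K) (hY : Y + K = Y) :
    (X ∩ Y).image π = X.image π ∩ Y.image π := by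
  refine Subset.antisymm (image_inter_subset _ _ _) fun q hq => ?_
  rw [mem_inter] at hq
  obtain ⟨x, hx, rfl⟩ := mem_image.1 hq.1
  exact mem_image_of_mem _ (mem_inter.2 ⟨hx, (mem_iff_apply_mem_image hker hY).2 hq.2⟩)

/-- [cite: BoothbyDevosMontejano2013, §8 (Claim 6)] -/
theorem image_sdiff_of_periodic (hker : ∀ x : G, π x = 0 ↔ x ∈ K) (hY : Y + K = Y) :
    (X \ Y).image π = X.image π \ Y.image π := by
  refine Subset.antisymm (fun q hq => ?_) (fun q hq => ?_)
  · obtain ⟨x, hx, rfl⟩ := mem_image.1 hq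
    rw [mem_sdiff] at hx ⊢
    exact ⟨mem_image_of_mem _ hx.1, fun h => hx.2 ((mem_iff_apply_mem_image hker hY).2 h)⟩
  · rw [mem_sdiff] at hq
    obtain ⟨x, hx, rfl⟩ := mem_image.1 hq.1
    exact mem_image_of_mem _ (mem_sdiff.2 ⟨hx, fun h => hq.2 (mem_image_of_mem _ h)⟩)

/-- [cite: BoothbyDevosMontejano2013, §8 (Claim 6)] -/
theorem image_compl_of_periodic [Fintype G] [Fintype Q] (hπ : Function.Surjective π)
    (hker : ∀ x : G, π x = 0 ↔ x ∈ K) (hX : X + K = X) : (Xᶜ).image π = (X.image π)ᶜ := by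
  rw [compl_eq_univ_sdiff, image_sdiff_of_periodic hker hX, image_univ_of_surjective hπ,
    compl_eq_univ_sdiff]

/-- [cite: BoothbyDevosMontejano2013, §8 (Claim 6)] -/
theorem image_third_of_periodic [Fintype G] [Fintype Q] (hπ : Function.Surjective π)
    (hker : ∀ x : G, π x = 0 ↔ x ∈ K) (hX : X + K = X) (Y : Finset G) :
    (third X Y).image π = third (X.image π) (Y.image π) := by
  have hK := isSubgroupCarrier_ker hker
  rw [third, third, image_compl_of_periodic hπ hker (periodic_neg hK (periodic_add hX Y)), image_neg,
    image_add]

/-- Images of `R`-sequences. [cite: BoothbyDevosMontejano2013, §8 (Claim 6)] -/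
theorem image_rseq (H : Finset G) (r a : G) (n : ℕ) :
    (rseq H r a n).image π = rseq (H.image π) (π r) (π a) n := by
  induction n with
  | zero => rw [rseq_zero, rseq_zero, image_empty]
  | succ n ih => rw [rseq_succ', rseq_succ', image_union, ih, image_vadd_distrib, map_add, map_nsmul]

/-- Images of trios with a periodic member. [cite: BoothbyDevosMontejano2013, §8 (Claim 6)] -/
theorem isTrio_image_iff (hker : ∀ x : G, π x = 0 ↔ x ∈ K) (hX : X + K = X) :
    IsTrio (X.image π) (Y.image π) (Z.image π) ↔ IsTrio X Y Z := by
  unfold IsTrio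
  rw [← image_add, ← image_add, not_iff_not]
  have hp : X + Y + Z + K = X + Y + Z := periodic_add (periodic_add hX Y) Z
  rw [← map_zero π, ← mem_iff_apply_mem_image hker hp]

/-- Cardinality of a periodic set. [cite: BoothbyDevosMontejano2013, §8 (Claim 6)] -/
theorem card_of_periodic (hker : ∀ x : G, π x = 0 ↔ x ∈ K) (hX : X + K = X) :
    #X = #(X.image π) * #K := by
  have hK := isSubgroupCarrier_ker hker
  rw [card_eq_sum_card_image π X]
  refine Finset.sum_const_nat fun q hq => ?_
  obtain ⟨x₀, hx₀, rfl⟩ := mem_image.1 hq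
  have hfib : X.filter (fun x => π x = π x₀) = x₀ +ᵥ K := by
    ext y
    rw [mem_filter, hK.mem_coset_iff, ← apply_eq_iff_sub_mem hker]
    refine ⟨fun h => h.2, fun h => ⟨?_, h⟩⟩
    have hk : y - x₀ ∈ K := (apply_eq_iff_sub_mem hker).1 h
    rw [← hX]; exact mem_add.2 ⟨x₀, hx₀, y - x₀, hk, by abel⟩
  rw [hfib, card_vadd_finset]

/-- In particular `|G| = |Q| · |K|`. [cite: BoothbyDevosMontejano2013, §8 (Claim 6)] -/
theorem card_univ_eq_mul [Fintype G] [Fintype Q] (hπ : Function.Surjective π)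
    (hker : ∀ x : G, π x = 0 ↔ x ∈ K) : Fintype.card G = Fintype.card Q * #K := by
  have h := card_of_periodic hker (X := (univ : Finset G)) (univ_add_of_zero_mem (zero_mem_ker hker))
  rwa [image_univ_of_surjective hπ, card_univ, card_univ] at h

/-- Deficiencies scale by `|K|`. [cite: BoothbyDevosMontejano2013, §8 (Claim 6)] -/
theorem trioDeficiency_eq_mul [Fintype G] [Fintype Q] (hπ : Function.Surjective π)
    (hker : ∀ x : G, π x = 0 ↔ x ∈ K) (hX : X + K = X) (hY : Y + K = Y) (hZ : Z + K = Z) :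
    trioDeficiency X Y Z = #K * trioDeficiency (X.image π) (Y.image π) (Z.image π) := by
  unfold trioDeficiency
  rw [card_of_periodic hker hX, card_of_periodic hker hY, card_of_periodic hker hZ,
    card_univ_eq_mul hπ hker]
  push_cast; ring

/-! ### Pullbacks -/

variable [Fintype G]

/-- The pullback of a finset of the quotient. [cite: BoothbyDevosMontejano2013, §8 (Claim 6)] -/
def pullback (π : G →+ Q) (S : Finset Q) : Finset G := univ.filter fun x => π x ∈ S

omit [DecidableEq G] in
/-- Unfolding lemma. [cite: BoothbyDevosMontejano2013, §8 (Claim 6)] -/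
theorem mem_pullback {S : Finset Q} : x ∈ pullback π S ↔ π x ∈ S := by
  rw [pullback, mem_filter]; exact ⟨fun h => h.2, fun h => ⟨mem_univ _, h⟩⟩

omit [DecidableEq G] in
/-- [cite: BoothbyDevosMontejano2013, §8 (Claim 6)] -/
theorem image_pullback (hπ : Function.Surjective π) (S : Finset Q) : (pullback π S).image π = S := by
  ext q
  refine ⟨fun h => ?_, fun h => ?_⟩
  · obtain ⟨x, hx, rfl⟩ := mem_image.1 h; exact mem_pullback.1 hx
  · obtain ⟨x, rfl⟩ := hπ q; exact mem_image_of_mem _ (mem_pullback.2 h)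

/-- [cite: BoothbyDevosMontejano2013, §8 (Claim 6)] -/
theorem pullback_periodic (hker : ∀ x : G, π x = 0 ↔ x ∈ K) (S : Finset Q) :
    pullback π S + K = pullback π S := by
  rw [periodic_iff (isSubgroupCarrier_ker hker)]
  intro x hx k hk
  rw [mem_pullback] at hx ⊢
  rwa [map_add, (hker k).2 hk, add_zero]

/-- A periodic set is the pullback of its image. [cite: BoothbyDevosMontejano2013, §8 (Claim 6)] -/
theorem eq_pullback_image (hπ : Function.Surjective π) (hker : ∀ x : G, π x = 0 ↔ x ∈ K)
    (hX : X + K = X) : X = pullback π (X.image π) :=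
  eq_of_image_eq hker hX (pullback_periodic hker _) (by rw [image_pullback hπ])

omit [DecidableEq G] in
/-- Pullbacks of subgroup carriers are subgroup carriers. [cite: BoothbyDevosMontejano2013, §8 (Claim 6)] -/
theorem isSubgroupCarrier_pullback {S : Finset Q} (hS : IsSubgroupCarrier S) :
    IsSubgroupCarrier (pullback π S) := by
  refine ⟨mem_pullback.2 (by rw [map_zero]; exact hS.zero_mem), fun x hx y hy => ?_⟩
  rw [mem_pullback] at hx hy ⊢
  rw [map_sub]; exact hS.sub_mem hx hy

omit [DecidableEq G] [Fintype G] in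
/-- Images of subgroup carriers are subgroup carriers. [cite: BoothbyDevosMontejano2013, §8 (Claim 6)] -/
theorem isSubgroupCarrier_image (hH : IsSubgroupCarrier H) : IsSubgroupCarrier (H.image π) := by
  refine ⟨mem_image.2 ⟨0, hH.zero_mem, map_zero π⟩, fun x hx y hy => ?_⟩
  obtain ⟨a, ha, rfl⟩ := mem_image.1 hx
  obtain ⟨b, hb, rfl⟩ := mem_image.1 hy
  rw [← map_sub]; exact mem_image_of_mem _ (hH.sub_mem ha hb)

omit [DecidableEq G] in
/-- `K ⊆ pullback S` for a subgroup carrier `S`. [cite: BoothbyDevosMontejano2013, §8 (Claim 6)] -/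
theorem ker_subset_pullback (hker : ∀ x : G, π x = 0 ↔ x ∈ K) {S : Finset Q}
    (hS : IsSubgroupCarrier S) : K ⊆ pullback π S := fun k hk =>
  mem_pullback.2 (by rw [(hker k).2 hk]; exact hS.zero_mem)

/-- Cosets: `X ⊆ c + pullback S ↔ image X ⊆ π c + S`. [cite: BoothbyDevosMontejano2013, §8 (Claim 6)] -/
theorem subset_coset_pullback_iff {S : Finset Q} {c : G} :
    X ⊆ c +ᵥ pullback π S ↔ X.image π ⊆ π c +ᵥ S := by
  constructor
  · intro h q hq
    obtain ⟨x, hx, rfl⟩ := mem_image.1 hq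
    obtain ⟨y, hy, rfl⟩ := mem_vadd_finset.1 (h hx)
    rw [vadd_eq_add, map_add]
    exact mem_vadd_finset.2 ⟨π y, mem_pullback.1 hy, rfl⟩
  · intro h x hx
    have := h (mem_image_of_mem _ hx)
    obtain ⟨s, hs, he⟩ := mem_vadd_finset.1 this
    refine mem_vadd_finset.2 ⟨x - c, mem_pullback.2 ?_, by rw [vadd_eq_add]; abel⟩
    rw [map_sub, ← he, vadd_eq_add, add_sub_cancel_left]; exact hs

/-- Stabilisers of periodic sets. [cite: BoothbyDevosMontejano2013, §8 (Claim 6)] -/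
theorem addStab_eq_pullback (hker : ∀ x : G, π x = 0 ↔ x ∈ K)
    (hX : X + K = X) (hXne : X.Nonempty) : X.addStab = pullback π (X.image π).addStab := by
  ext g
  rw [mem_pullback, mem_addStab hXne, mem_addStab (hXne.image _), ← image_vadd_distrib]
  constructor
  · intro h; rw [h]
  · intro h; exact eq_of_image_eq hker (periodic_vadd hX g) hX h

/-- Generation of the quotient lifts. [cite: BoothbyDevosMontejano2013, §8 (Claim 6)] -/
theorem isCyclicQuotGen_pullback {S : Finset Q} {r : G} (h : IsCyclicQuotGen S (π r)) :
    IsCyclicQuotGen (pullback π S) r := by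
  intro x
  obtain ⟨i, hi⟩ := h (π x)
  refine ⟨i, ?_⟩
  have : ({x} : Finset G).image π ⊆ π (i • r) +ᵥ S := by
    rw [image_singleton, singleton_subset_iff, map_nsmul]; exact hi
  exact singleton_subset_iff.1 (subset_coset_pullback_iff.2 this)

end Transport

/-! ## Lifting similar triples and the four structures -/

section Lift

variable {G Q : Type*} [AddCommGroup G] [DecidableEq G] [Fintype G] [AddCommGroup Q] [DecidableEq Q]
  [Fintype Q]
variable {π : G →+ Q} {K X Y Z : Finset G} {Hq A₀ B₀ C₀ : Finset Q} {r : G}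

omit [Fintype G] [Fintype Q] in
/-- A triple similar (in the quotient) to the image of a periodic triple is the image of a periodic
triple similar to it. [cite: BoothbyDevosMontejano2013, §8 (Claim 6)] -/
theorem exists_lift_of_similar' (hπ : Function.Surjective π) (hX : X + K = X) (hY : Y + K = Y)
    (hZ : Z + K = Z) {U : Finset Q × Finset Q × Finset Q}
    (h : Similar (X.image π, Y.image π, Z.image π) U) :
    ∃ X₀ Y₀ Z₀ : Finset G, X₀ + K = X₀ ∧ Y₀ + K = Y₀ ∧ Z₀ + K = Z₀ ∧
      X₀.image π = U.1 ∧ Y₀.image π = U.2.1 ∧ Z₀.image π = U.2.2 ∧ Similar (X, Y, Z) (X₀, Y₀, Z₀) := by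
  generalize hT : (X.image π, Y.image π, Z.image π) = T at h
  induction h with
  | refl => exact ⟨X, Y, Z, hX, hY, hZ, by rw [← hT], by rw [← hT], by rw [← hT], Similar.refl _⟩
  | rotate _ ih =>
    obtain ⟨X₀, Y₀, Z₀, h1, h2, h3, e1, e2, e3, hs⟩ := ih
    exact ⟨Y₀, Z₀, X₀, h2, h3, h1, e2, e3, e1, hs.rotate⟩
  | swap _ ih =>
    obtain ⟨X₀, Y₀, Z₀, h1, h2, h3, e1, e2, e3, hs⟩ := ih
    exact ⟨Y₀, X₀, Z₀, h2, h1, h3, e2, e1, e3, hs.swap⟩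
  | translate g _ ih =>
    obtain ⟨X₀, Y₀, Z₀, h1, h2, h3, e1, e2, e3, hs⟩ := ih
    obtain ⟨g', rfl⟩ := hπ g
    refine ⟨g' +ᵥ X₀, (-g') +ᵥ Y₀, Z₀, periodic_vadd h1 g', periodic_vadd h2 (-g'), h3, ?_, ?_, e3,
      hs.translate g'⟩
    · simp only [image_vadd_distrib, e1]
    · simp only [image_vadd_distrib, map_neg, e2]

omit [Fintype G] [Fintype Q] in
/-- Component form of `exists_lift_of_similar'`. [cite: BoothbyDevosMontejano2013, §8 (Claim 6)] -/
theorem exists_lift_of_similar (hπ : Function.Surjective π) (hX : X + K = X) (hY : Y + K = Y)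
    (hZ : Z + K = Z) (h : Similar (X.image π, Y.image π, Z.image π) (A₀, B₀, C₀)) :
    ∃ X₀ Y₀ Z₀ : Finset G, X₀ + K = X₀ ∧ Y₀ + K = Y₀ ∧ Z₀ + K = Z₀ ∧
      X₀.image π = A₀ ∧ Y₀.image π = B₀ ∧ Z₀.image π = C₀ ∧ Similar (X, Y, Z) (X₀, Y₀, Z₀) :=
  exists_lift_of_similar' hπ hX hY hZ h

/-- Lifting a pure beat in normal position. [cite: BoothbyDevosMontejano2013, §8 (Claim 6); Def 4.1] -/
theorem isPureBeatAt_lift (hπ : Function.Surjective π) (hker : ∀ x : G, π x = 0 ↔ x ∈ K)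
    (hX : X + K = X) (hY : Y + K = Y) (hZ : Z + K = Z) (hHq : IsSubgroupCarrier Hq)
    (h : IsPureBeatAt Hq (X.image π) (Y.image π) (Z.image π)) :
    IsPureBeatAt (pullback π Hq) X Y Z := by
  obtain ⟨hA, hB, hC, hCne⟩ := h
  have hK := isSubgroupCarrier_ker hker
  have hYne : Y.Nonempty := by
    rw [← image_nonempty (f := π)]
    by_contra hne
    rw [not_nonempty_iff_eq_empty] at hne
    rw [hne, addStab_empty] at hB
    exact (notMem_empty (0 : Q)) (hB ▸ hHq.zero_mem)
  refine ⟨?_, ?_, ?_, (image_nonempty.1 hCne)⟩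
  · rw [eq_pullback_image hπ hker hX, hA]
  · rw [addStab_eq_pullback hker hY hYne, hB]
  · exact eq_of_image_eq hker hZ (periodic_third hK hX Y) (by rw [image_third_of_periodic hπ hker hX, hC])

/-- Lifting a pure chord in normal position. [cite: BoothbyDevosMontejano2013, §8 (Claim 6); Def 4.2] -/
theorem isPureChordAt_lift (hπ : Function.Surjective π) (hker : ∀ x : G, π x = 0 ↔ x ∈ K)
    (hX : X + K = X) (hY : Y + K = Y) (hZ : Z + K = Z)
    (h : IsPureChordAt Hq (π r) (X.image π) (Y.image π) (Z.image π)) :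
    IsPureChordAt (pullback π Hq) r X Y Z := by
  obtain ⟨hgen, ⟨a, m, hm, hA⟩, ⟨b, n, hn, hB⟩, hC, hCc⟩ := h
  have hK := isSubgroupCarrier_ker hker
  have hHp : pullback π Hq + K = pullback π Hq := pullback_periodic hker Hq
  obtain ⟨a', rfl⟩ := hπ a
  obtain ⟨b', rfl⟩ := hπ b
  refine ⟨isCyclicQuotGen_pullback hgen, ⟨a', m, hm, ?_⟩, ⟨b', n, hn, ?_⟩, ?_, fun c hc => ?_⟩
  · exact eq_of_image_eq hker hX (periodic_rseq hHp r a' m) (by rw [image_rseq, image_pullback hπ, hA])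
  · exact eq_of_image_eq hker hY (periodic_rseq hHp r b' n) (by rw [image_rseq, image_pullback hπ, hB])
  · exact eq_of_image_eq hker hZ (periodic_third hK hX Y) (by rw [image_third_of_periodic hπ hker hX, hC])
  · exact hCc (π c) (subset_coset_pullback_iff.1 hc)

/-- Lifting an impure beat in normal position (first member nonempty).
[cite: BoothbyDevosMontejano2013, §8 (Claim 6); Def 4.3] -/
theorem isImpureBeatAt_lift (hπ : Function.Surjective π) (hker : ∀ x : G, π x = 0 ↔ x ∈ K)
    (hX : X + K = X) (hY : Y + K = Y) (hZ : Z + K = Z) (hXne : X.Nonempty) (hHq : IsSubgroupCarrier Hq)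
    (h : IsImpureBeatAt Hq (X.image π) (Y.image π) (Z.image π)) :
    IsImpureBeatAt (pullback π Hq) X Y Z := by
  obtain ⟨hA, hcl, hB, hC, hBne, hCne⟩ := h
  have hK := isSubgroupCarrier_ker hker
  have hHp : pullback π Hq + K = pullback π Hq := pullback_periodic hker Hq
  have hH := isSubgroupCarrier_pullback (π := π) hHq
  have himH : (pullback π Hq).image π = Hq := image_pullback hπ Hq
  refine ⟨fun x hx => mem_pullback.2 (hA (mem_image_of_mem _ hx)), ⟨?_, ?_⟩, ?_, ?_, ?_, ?_⟩
  · obtain ⟨a, ha⟩ := hcl.1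
    obtain ⟨a', rfl⟩ := hπ a
    exact ⟨a', subset_coset_pullback_iff.2 ha⟩
  · intro K' hK' hK'H ⟨a, ha⟩
    -- `K ⊆ K'`, so `K'` is periodic and is the pullback of its image
    obtain ⟨x₀, hx₀⟩ := hXne
    have hKK' : K ⊆ K' := by
      intro k hk
      have h1 := ha hx₀
      have h2 := ha ((periodic_iff hK).1 hX x₀ hx₀ k hk)
      rw [hK'.mem_coset_iff] at h1 h2
      have := hK'.sub_mem h2 h1
      rwa [show x₀ + k - a - (x₀ - a) = k by abel] at this
    have hK'p : K' + K = K' := periodic_of_subset hK' (zero_mem_ker hker) hKK'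
    have hK'eq := eq_pullback_image hπ hker hK'p
    have himK' : IsSubgroupCarrier (K'.image π) := isSubgroupCarrier_image hK'
    have hsub : K'.image π ⊆ Hq := by rw [← himH]; exact image_subset_image hK'H
    have hcos : ∃ q : Q, X.image π ⊆ q +ᵥ K'.image π :=
      ⟨π a, by rw [← image_vadd_distrib]; exact image_subset_image ha⟩
    have := hcl.2 himK' hsub hcos
    rw [hK'eq, this]
  · refine eq_of_image_eq hker (periodic_add_left hHp _) (periodic_sdiff hK hY hHp) ?_
    rw [image_add, image_sdiff_of_periodic hker hHp, himH, hB]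
  · refine eq_of_image_eq hker (periodic_sdiff hK hZ hHp)
      (periodic_sdiff hK (periodic_third hK hX Y) hHp) ?_
    rw [image_sdiff_of_periodic hker hHp, image_sdiff_of_periodic hker hHp,
      image_third_of_periodic hπ hker hX, himH, hC]
  · rw [← image_nonempty (f := π), image_inter_of_periodic hker hHp, himH]; exact hBne
  · rw [← image_nonempty (f := π), image_inter_of_periodic hker hHp, himH]; exact hCne

/-- Lifting an impure chord in normal position. [cite: BoothbyDevosMontejano2013, §8 (Claim 6); Def 4.4] -/
theorem isImpureChordAt_lift (hπ : Function.Surjective π) (hker : ∀ x : G, π x = 0 ↔ x ∈ K)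
    (hX : X + K = X) (hY : Y + K = Y) (hZ : Z + K = Z)
    (h : IsImpureChordAt Hq (π r) (X.image π) (Y.image π) (Z.image π)) :
    IsImpureChordAt (pullback π Hq) r X Y Z := by
  obtain ⟨hgen, ⟨m, hm, hA⟩, ⟨n, hn, hB⟩, hC, hCHne, hAne, hBne, hCne⟩ := h
  have hK := isSubgroupCarrier_ker hker
  have hHp : pullback π Hq + K = pullback π Hq := pullback_periodic hker Hq
  have himH : (pullback π Hq).image π = Hq := image_pullback hπ Hq
  refine ⟨isCyclicQuotGen_pullback hgen, ⟨m, hm, ?_⟩, ⟨n, hn, ?_⟩, ?_, ?_, ?_, ?_, ?_⟩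
  · refine eq_of_image_eq hker (periodic_union hHp hX) (periodic_rseq hHp r 0 m) ?_
    rw [image_union, himH, hA, image_rseq, himH, map_zero]
  · refine eq_of_image_eq hker (periodic_union hHp hY) (periodic_rseq hHp r 0 n) ?_
    rw [image_union, himH, hB, image_rseq, himH, map_zero]
  · refine eq_of_image_eq hker (periodic_sdiff hK hZ hHp)
      (periodic_sdiff hK (periodic_third hK hX Y) hHp) ?_
    rw [image_sdiff_of_periodic hker hHp, image_sdiff_of_periodic hker hHp,
      image_third_of_periodic hπ hker hX, himH, hC]
  · rw [← image_nonempty (f := π), image_sdiff_of_periodic hker hHp, himH]; exact hCHne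
  · rw [← image_nonempty (f := π), image_inter_of_periodic hker hHp, himH]; exact hAne
  · rw [← image_nonempty (f := π), image_inter_of_periodic hker hHp, himH]; exact hBne
  · rw [← image_nonempty (f := π), image_inter_of_periodic hker hHp, himH]; exact hCne

/-- **Claim 6 (the lift).**  If the image of a `K`-periodic nonempty triple `(X,Y,Z)` in `Q = G/K`
is a pure beat, pure chord, impure beat or impure chord relative to `H̄ < Q`, then `(X,Y,Z)` is one
relative to the pullback of `H̄`. [cite: BoothbyDevosMontejano2013, §8 (Claim 6)] -/
theorem structure_lift (hπ : Function.Surjective π) (hker : ∀ x : G, π x = 0 ↔ x ∈ K)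
    (hX : X + K = X) (hY : Y + K = Y) (hZ : Z + K = Z) (hXne : X.Nonempty) (hYne : Y.Nonempty)
    (hZne : Z.Nonempty) (hHq : IsSubgroupCarrier Hq)
    (h : IsPureBeat Hq (X.image π, Y.image π, Z.image π) ∨
      IsPureChord Hq (X.image π, Y.image π, Z.image π) ∨
      IsImpureBeat Hq (X.image π, Y.image π, Z.image π) ∨
      IsImpureChord Hq (X.image π, Y.image π, Z.image π)) :
    IsPureBeat (pullback π Hq) (X, Y, Z) ∨ IsPureChord (pullback π Hq) (X, Y, Z) ∨
      IsImpureBeat (pullback π Hq) (X, Y, Z) ∨ IsImpureChord (pullback π Hq) (X, Y, Z) := by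
  rcases h with ⟨A₀, B₀, C₀, hAt, hs⟩ | ⟨r₀, A₀, B₀, C₀, hAt, hs⟩ | ⟨A₀, B₀, C₀, hAt, hs⟩ |
    ⟨r₀, A₀, B₀, C₀, hAt, hs⟩
  · obtain ⟨X₀, Y₀, Z₀, h1, h2, h3, e1, e2, e3, hsim⟩ := exists_lift_of_similar hπ hX hY hZ hs.symm
    refine Or.inl ⟨X₀, Y₀, Z₀, isPureBeatAt_lift hπ hker h1 h2 h3 hHq ?_, hsim.symm⟩
    rw [e1, e2, e3]; exact hAt
  · obtain ⟨X₀, Y₀, Z₀, h1, h2, h3, e1, e2, e3, hsim⟩ := exists_lift_of_similar hπ hX hY hZ hs.symm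
    obtain ⟨r, rfl⟩ := hπ r₀
    refine Or.inr (Or.inl ⟨r, X₀, Y₀, Z₀, isPureChordAt_lift hπ hker h1 h2 h3 ?_, hsim.symm⟩)
    rw [e1, e2, e3]; exact hAt
  · obtain ⟨X₀, Y₀, Z₀, h1, h2, h3, e1, e2, e3, hsim⟩ := exists_lift_of_similar hπ hX hY hZ hs.symm
    have hX₀ne : X₀.Nonempty := ((hsim.nonempty_iff).1 ⟨hXne, hYne, hZne⟩).1
    refine Or.inr (Or.inr (Or.inl ⟨X₀, Y₀, Z₀, isImpureBeatAt_lift hπ hker h1 h2 h3 hX₀ne hHq ?_,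
      hsim.symm⟩))
    rw [e1, e2, e3]; exact hAt
  · obtain ⟨X₀, Y₀, Z₀, h1, h2, h3, e1, e2, e3, hsim⟩ := exists_lift_of_similar hπ hX hY hZ hs.symm
    obtain ⟨r, rfl⟩ := hπ r₀
    refine Or.inr (Or.inr (Or.inr ⟨r, X₀, Y₀, Z₀, isImpureChordAt_lift hπ hker h1 h2 h3 ?_,
      hsim.symm⟩))
    rw [e1, e2, e3]; exact hAt

end Lift

/-! ## Theorem 4.5 (one step) -/

section Main

variable {G : Type*} [AddCommGroup G] [DecidableEq G]

/-- Every triple is similar to one with `|A| ≤ |B| ≤ |C|` (a permutation).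
[cite: BoothbyDevosMontejano2013, §8] -/
theorem exists_similar_sorted (A B C : Finset G) : ∃ A' B' C' : Finset G,
    Similar (A', B', C') (A, B, C) ∧ #A' ≤ #B' ∧ #B' ≤ #C' ∧
      max (#A') (max (#B') (#C')) = max (#A) (max (#B) (#C)) := by
  have r1 : Similar (A, B, C) (B, C, A) := (Similar.refl _).rotate
  have r2 : Similar (A, B, C) (C, A, B) := r1.rotate
  have s0 : Similar (A, B, C) (B, A, C) := (Similar.refl _).swap
  have s1 : Similar (A, B, C) (C, B, A) := r1.swap
  have s2 : Similar (A, B, C) (A, C, B) := r2.swap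
  rcases le_total #A #B with hab | hba <;> rcases le_total #B #C with hbc | hcb <;>
    rcases le_total #A #C with hac | hca
  · exact ⟨A, B, C, Similar.refl _, hab, hbc, rfl⟩
  · exact ⟨A, B, C, Similar.refl _, hab, hbc, rfl⟩
  · exact ⟨A, C, B, s2.symm, hac, hcb, by omega⟩
  · exact ⟨C, A, B, r2.symm, hca, hab, by omega⟩
  · exact ⟨B, A, C, s0.symm, hba, hac, by omega⟩
  · exact ⟨B, C, A, r1.symm, hbc, hca, by omega⟩
  · exact ⟨C, B, A, s1.symm, hcb, hba, by omega⟩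
  · exact ⟨C, B, A, s1.symm, hcb, hba, by omega⟩

/-- **Theorem 4.5 (Kemperman's structure theorem), one step, for finite abelian groups.**  Every
maximal nontrivial critical trio `(A,B,C)` (`δ(A,B,C) > 0`, all members nonempty) of a finite
abelian group `G` is a pure beat, a pure chord, an impure beat or an impure chord relative to some
proper subgroup `H < G` (the four similarity-closed notions of Definitions 4.1–4.4).  The printed
recursive statement — a chain `Υ₁, …, Υ_m` in subgroups `G₁ > G₂ > ⋯ > G_m`, each impure with
continuation the next and the last pure — follows by iterating this step on the continuations
(`IsImpureBeat.exists_continuation`, `IsImpureChord.exists_continuation`: the continuation is a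
maximal nontrivial critical trio inside `H`).  Proof as in §8: induction on `|G|` (criterion 1) and
on `|G ∖ C|` for `|A| ≤ |B| ≤ |C|` (criterion 2); Claim 6 passes to `G / stab(A)` (`structure_lift`)
when the stabiliser is nontrivial, and `kemperman_step_of_addStab_eq_singleton` (Claims 7–12 and
the final step) handles the trivial stabiliser. [cite: BoothbyDevosMontejano2013, Thm 4.5; §8] -/
theorem kemperman_structure_step {G : Type*} [AddCommGroup G] [Fintype G] [DecidableEq G]
    {A B C : Finset G} (hmax : IsMaximalTrio A B C) (hδ : 0 < trioDeficiency A B C)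
    (hA : A.Nonempty) (hB : B.Nonempty) (hC : C.Nonempty) :
    ∃ H : Finset G, IsSubgroupCarrier H ∧ H ≠ univ ∧
      (IsPureBeat H (A, B, C) ∨ IsPureChord H (A, B, C) ∨ IsImpureBeat H (A, B, C) ∨
        IsImpureChord H (A, B, C)) := by
  -- induction on `|G|` over all finite abelian groups (criterion 1)
  suffices key : ∀ (n : ℕ) (G : Type _) [AddCommGroup G] [Fintype G] [DecidableEq G],
      Fintype.card G = n → ∀ (A B C : Finset G), IsMaximalTrio A B C → 0 < trioDeficiency A B C →
      A.Nonempty → B.Nonempty → C.Nonempty → ∃ H : Finset G, IsSubgroupCarrier H ∧ H ≠ univ ∧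
        (IsPureBeat H (A, B, C) ∨ IsPureChord H (A, B, C) ∨ IsImpureBeat H (A, B, C) ∨
          IsImpureChord H (A, B, C)) from key _ G rfl A B C hmax hδ hA hB hC
  intro n
  induction n using Nat.strong_induction_on with
  | _ n ihn => ?_
  intro G _ _ _ hcard
  -- induction on `|G| − max(|A|,|B|,|C|)` (criterion 2)
  suffices inner : ∀ (m : ℕ) (A B C : Finset G),
      Fintype.card G - max (#A) (max (#B) (#C)) = m → IsMaximalTrio A B C →
      0 < trioDeficiency A B C → A.Nonempty → B.Nonempty → C.Nonempty →
      ∃ H : Finset G, IsSubgroupCarrier H ∧ H ≠ univ ∧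
        (IsPureBeat H (A, B, C) ∨ IsPureChord H (A, B, C) ∨ IsImpureBeat H (A, B, C) ∨
          IsImpureChord H (A, B, C)) from fun A B C => inner _ A B C rfl
  intro m
  induction m using Nat.strong_induction_on with
  | _ m ihm => ?_
  intro A₁ B₁ C₁ hm hmax₁ hδ₁ hA₁ hB₁ hC₁
  -- sort: `|A| ≤ |B| ≤ |C|`
  obtain ⟨A, B, C, hsim, hAB, hBC, hmaxeq⟩ := exists_similar_sorted A₁ B₁ C₁
  have hmax : IsMaximalTrio A B C := hsim.isMaximalTrio_iff.2 hmax₁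
  have hδ : 0 < trioDeficiency A B C := by rwa [hsim.trioDeficiency_eq]
  obtain ⟨hA, hB, hC⟩ := hsim.nonempty_iff.2 ⟨hA₁, hB₁, hC₁⟩
  suffices goal : ∃ H : Finset G, IsSubgroupCarrier H ∧ H ≠ univ ∧
      (IsPureBeat H (A, B, C) ∨ IsPureChord H (A, B, C) ∨ IsImpureBeat H (A, B, C) ∨
        IsImpureChord H (A, B, C)) by
    obtain ⟨H, hH, hHu, h⟩ := goal
    refine ⟨H, hH, hHu, ?_⟩
    rcases h with h | h | h | h
    · exact Or.inl (h.similar hsim)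
    · exact Or.inr (Or.inl (h.similar hsim))
    · exact Or.inr (Or.inr (Or.inl (h.similar hsim)))
    · exact Or.inr (Or.inr (Or.inr (h.similar hsim)))
  have hCmax : max (#A) (max (#B) (#C)) = #C := by
    rw [max_eq_right hBC, max_eq_right (hAB.trans hBC)]
  -- the inner induction hypothesis in the form `StepBelow C`
  have ih : StepBelow C := by
    intro A₂ B₂ C₂ hmax₂ hδ₂ hA₂ hB₂ hC₂ hlt
    have hle : max (#A₂) (max (#B₂) (#C₂)) ≤ Fintype.card G :=
      max_le (card_le_univ _) (max_le (card_le_univ _) (card_le_univ _))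
    have hlt' : #C < max (#A₂) (max (#B₂) (#C₂)) := lt_of_lt_of_le hlt (le_max_of_le_right (le_max_right _ _))
    refine ihm _ ?_ A₂ B₂ C₂ rfl hmax₂ hδ₂ hA₂ hB₂ hC₂
    rw [← hm, ← hmaxeq, hCmax]; omega
  by_cases h6 : A.addStab = {0}
  · exact kemperman_step_of_addStab_eq_singleton hmax hδ hA hB hC hAB hBC h6 ih
  -- CLAIM 6: nontrivial stabiliser — pass to the quotient `G / K`
  classical
  set K := A.addStab with hKdef
  have hK : IsSubgroupCarrier K := IsSubgroupCarrier.of_addStab hA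
  have hstab := hmax.addStab_eq hA hB hC
  have hAK : A + K = A := add_addStab A
  have hBK : B + K = B := by rw [hKdef, hstab.1]; exact add_addStab B
  have hCK : C + K = C := by rw [hKdef, hstab.1, hstab.2]; exact add_addStab C
  have hK2 : 2 ≤ #K := by
    by_contra hlt
    apply h6
    have h0 : ({0} : Finset G) ⊆ K := singleton_subset_iff.2 hK.zero_mem
    exact (eq_of_subset_of_card_le h0 (by rw [card_singleton]; omega)).symm
  let K' := hK.toAddSubgroup
  haveI : Fintype (G ⧸ K') := Fintype.ofFinite _
  let π : G →+ G ⧸ K' := QuotientAddGroup.mk' K'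
  have hπ : Function.Surjective π := QuotientAddGroup.mk'_surjective K'
  have hker : ∀ x : G, π x = 0 ↔ x ∈ K := fun x => by
    rw [QuotientAddGroup.mk'_apply, QuotientAddGroup.eq_zero_iff, hK.mem_toAddSubgroup]
  have hcardQ := card_univ_eq_mul hπ hker
  have hlt : Fintype.card (G ⧸ K') < n := by
    rw [← hcard, hcardQ]
    have : 0 < Fintype.card (G ⧸ K') := Fintype.card_pos
    nlinarith
  -- the image trio is maximal, nontrivial, critical
  obtain ⟨eC, eB, eA⟩ := isMaximalTrio_iff.1 hmax
  have hmaxQ : IsMaximalTrio (A.image π) (B.image π) (C.image π) := by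
    refine isMaximalTrio_iff.2 ⟨?_, ?_, ?_⟩
    · rw [← image_third_of_periodic hπ hker hAK, ← eC]
    · rw [← image_third_of_periodic hπ hker hAK, ← eB]
    · rw [← image_third_of_periodic hπ hker hBK, ← eA]
  have hδQ : 0 < trioDeficiency (A.image π) (B.image π) (C.image π) := by
    have h := trioDeficiency_eq_mul hπ hker hAK hBK hCK
    rw [h] at hδ
    exact pos_of_mul_pos_right hδ (by exact_mod_cast (Nat.zero_le #K))
  obtain ⟨Hq, hHq, hHqu, hstr⟩ := ihn _ hlt (G ⧸ K') rfl (A.image π) (B.image π) (C.image π) hmaxQ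
    hδQ (hA.image _) (hB.image _) (hC.image _)
  refine ⟨pullback π Hq, isSubgroupCarrier_pullback hHq, fun hu => hHqu ?_,
    structure_lift hπ hker hAK hBK hCK hA hB hC hHq hstr⟩
  rw [← image_pullback hπ Hq, hu, image_univ_of_surjective hπ]

end Main

/-! ## Theorem 4.5 as printed: the chain of continuations -/

section Chain

universe u

variable {G : Type u} [AddCommGroup G] [DecidableEq G]

/-- Transport of a finset of `G` into the subgroup type `↥H'` (keeping the elements that lie in `H'`).
[cite: BoothbyDevosMontejano2013, Thm 4.5] -/
noncomputable def toSub (H' : AddSubgroup G) (X : Finset G) : Finset ↥H' :=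
  @Finset.subtype G (· ∈ H') (Classical.decPred _) X

omit [DecidableEq G] in
/-- Unfolding lemma. [cite: BoothbyDevosMontejano2013, Thm 4.5] -/
theorem mem_toSub {H' : AddSubgroup G} {X : Finset G} {x : ↥H'} : x ∈ toSub H' X ↔ (x : G) ∈ X := by
  unfold toSub; exact @Finset.mem_subtype G (· ∈ H') (Classical.decPred _) X x

variable {H' : AddSubgroup G} {X Y Z : Finset G}

/-- [cite: BoothbyDevosMontejano2013, Thm 4.5] -/
theorem image_val_toSub (hX : (X : Set G) ⊆ H') : (toSub H' X).image Subtype.val = X := by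
  ext y
  constructor
  · intro h
    obtain ⟨x, hx, rfl⟩ := mem_image.1 h
    exact mem_toSub.1 hx
  · intro hy
    exact mem_image.2 ⟨⟨y, hX (mem_coe.2 hy)⟩, mem_toSub.2 hy, rfl⟩

/-- [cite: BoothbyDevosMontejano2013, Thm 4.5] -/
theorem toSub_image_val [DecidableEq ↥H'] (X' : Finset ↥H') : toSub H' (X'.image Subtype.val) = X' := by
  ext x
  rw [mem_toSub, mem_image]
  constructor
  · rintro ⟨y, hy, he⟩; rwa [← Subtype.ext he]
  · intro hx; exact ⟨x, hx, rfl⟩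

omit [DecidableEq G] in
/-- [cite: BoothbyDevosMontejano2013, Thm 4.5] -/
theorem coe_image_val_subset [DecidableEq G] (X' : Finset ↥H') :
    ((X'.image Subtype.val : Finset G) : Set G) ⊆ H' := by
  intro y hy
  obtain ⟨x, -, rfl⟩ := mem_image.1 (mem_coe.1 hy)
  exact x.2

/-- [cite: BoothbyDevosMontejano2013, Thm 4.5] -/
theorem card_toSub (hX : (X : Set G) ⊆ H') : #(toSub H' X) = #X := by
  conv_rhs => rw [← image_val_toSub hX]
  rw [card_image_of_injective _ Subtype.val_injective]

omit [DecidableEq G] in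
/-- [cite: BoothbyDevosMontejano2013, Thm 4.5] -/
theorem toSub_mono (h : X ⊆ Y) : toSub H' X ⊆ toSub H' Y := fun _ hx => mem_toSub.2 (h (mem_toSub.1 hx))

omit [DecidableEq G] in
/-- [cite: BoothbyDevosMontejano2013, Thm 4.5] -/
theorem toSub_nonempty (hX : (X : Set G) ⊆ H') (hne : X.Nonempty) : (toSub H' X).Nonempty := by
  obtain ⟨x, hx⟩ := hne
  exact ⟨⟨x, hX (mem_coe.2 hx)⟩, mem_toSub.2 hx⟩

/-- Trios transport to the subgroup type. [cite: BoothbyDevosMontejano2013, Thm 4.5] -/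
theorem isTrio_toSub_iff [DecidableEq ↥H'] (hX : (X : Set G) ⊆ H') (hY : (Y : Set G) ⊆ H')
    (hZ : (Z : Set G) ⊆ H') : IsTrio (toSub H' X) (toSub H' Y) (toSub H' Z) ↔ IsTrio X Y Z := by
  unfold IsTrio
  rw [not_iff_not]
  constructor
  · intro h
    obtain ⟨ab, hab, c, hc, e⟩ := mem_add.1 h
    obtain ⟨a, ha, b, hb, rfl⟩ := mem_add.1 hab
    refine mem_add.2 ⟨(a : G) + b, mem_add.2 ⟨a, mem_toSub.1 ha, b, mem_toSub.1 hb, rfl⟩, c,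
      mem_toSub.1 hc, ?_⟩
    have := congrArg Subtype.val e
    simpa using this
  · intro h
    obtain ⟨ab, hab, c, hc, e⟩ := mem_add.1 h
    obtain ⟨a, ha, b, hb, rfl⟩ := mem_add.1 hab
    have ha' : a ∈ H' := hX (mem_coe.2 ha)
    have hb' : b ∈ H' := hY (mem_coe.2 hb)
    have hc' : c ∈ H' := hZ (mem_coe.2 hc)
    refine mem_add.2 ⟨⟨a, ha'⟩ + ⟨b, hb'⟩, mem_add.2 ⟨⟨a, ha'⟩, mem_toSub.2 ha, ⟨b, hb'⟩,
      mem_toSub.2 hb, rfl⟩, ⟨c, hc'⟩, mem_toSub.2 hc, ?_⟩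
    exact Subtype.ext (by simpa using e)

/-- Maximal trios IN `H` transport to maximal trios of `↥H`. [cite: BoothbyDevosMontejano2013, Thm 4.5] -/
theorem isMaximalTrio_toSub [DecidableEq ↥H'] {H : Finset G} (hHH' : ∀ x, x ∈ H' ↔ x ∈ H)
    (h : IsMaximalTrioIn H X Y Z) : IsMaximalTrio (toSub H' X) (toSub H' Y) (toSub H' Z) := by
  obtain ⟨hXH, hYH, hZH, ht, hmax⟩ := h
  have cv : ∀ {W : Finset G}, W ⊆ H → (W : Set G) ⊆ H' := fun hW y hy => (hHH' y).2 (hW (mem_coe.1 hy))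
  refine ⟨(isTrio_toSub_iff (cv hXH) (cv hYH) (cv hZH)).2 ht, fun X' Y' Z' hX' hY' hZ' ht' => ?_⟩
  have bk : ∀ (W' : Finset ↥H'), (W'.image Subtype.val : Finset G) ⊆ H := fun W' y hy => by
    obtain ⟨x, -, rfl⟩ := mem_image.1 hy; exact (hHH' x).1 x.2
  have sub : ∀ {W : Finset G} {W' : Finset ↥H'}, toSub H' W ⊆ W' → (W : Set G) ⊆ H' →
      W ⊆ W'.image Subtype.val := fun hW hWH y hy =>
    mem_image.2 ⟨⟨y, hWH (mem_coe.2 hy)⟩, hW (mem_toSub.2 hy), rfl⟩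
  have ht'' : IsTrio (X'.image Subtype.val) (Y'.image Subtype.val) (Z'.image Subtype.val) := by
    rw [← isTrio_toSub_iff (coe_image_val_subset X') (coe_image_val_subset Y') (coe_image_val_subset Z'),
      toSub_image_val, toSub_image_val, toSub_image_val]
    exact ht'
  obtain ⟨e1, e2, e3⟩ := hmax (sub hX' (cv hXH)) (sub hY' (cv hYH)) (sub hZ' (cv hZH)) (bk X') (bk Y')
    (bk Z') ht''
  refine ⟨?_, ?_, ?_⟩
  · rw [← toSub_image_val X', e1]
  · rw [← toSub_image_val Y', e2]
  · rw [← toSub_image_val Z', e3]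

/-- Deficiency IN `H` is the deficiency in `↥H`. [cite: BoothbyDevosMontejano2013, Thm 4.5] -/
theorem trioDeficiency_toSub [Fintype ↥H'] {H : Finset G} (hHH' : ∀ x, x ∈ H' ↔ x ∈ H) (hXH : X ⊆ H)
    (hYH : Y ⊆ H) (hZH : Z ⊆ H) :
    trioDeficiency (toSub H' X) (toSub H' Y) (toSub H' Z) = trioDeficiencyIn H X Y Z := by
  classical
  have cv : ∀ {W : Finset G}, W ⊆ H → (W : Set G) ⊆ H' := fun hW y hy => (hHH' y).2 (hW (mem_coe.1 hy))
  have hH : toSub H' H = univ := eq_univ_of_forall fun x => mem_toSub.2 ((hHH' x).1 x.2)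
  have hcard : Fintype.card ↥H' = #H := by
    rw [← card_univ, ← hH, card_toSub (cv Subset.rfl)]
  unfold trioDeficiency; rw [trioDeficiencyIn_def, card_toSub (cv hXH), card_toSub (cv hYH),
    card_toSub (cv hZH), hcard]

/-- **The printed form of Theorem 4.5: Kemperman chains.**  `KempermanChain A B C` says: there is a
sequence of trios `Υ₁ = (A,B,C), Υ₂, …, Υ_m` in subgroups `G = G₁ > G₂ > ⋯ > G_m`, each `Υ_i`
(`i < m`) an impure beat or an impure chord relative to `G_{i+1}` with continuation `Υ_{i+1}`
(transported to the group `↥G_{i+1}`), and `Υ_m` a pure beat or a pure chord (relative to a proper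
subgroup). [cite: BoothbyDevosMontejano2013, Thm 4.5] -/
inductive KempermanChain : ∀ {G : Type u} [AddCommGroup G] [Fintype G] [DecidableEq G],
    Finset G → Finset G → Finset G → Prop
  | pure {G : Type u} [AddCommGroup G] [Fintype G] [DecidableEq G] {A B C : Finset G} (H : Finset G)
      (hH : IsSubgroupCarrier H) (hHu : H ≠ univ)
      (h : IsPureBeat H (A, B, C) ∨ IsPureChord H (A, B, C)) : KempermanChain A B C
  | impureBeat {G : Type u} [AddCommGroup G] [Fintype G] [DecidableEq G] {A B C : Finset G}
      (H : Finset G) (hH : IsSubgroupCarrier H) (hHu : H ≠ univ) (A₀ B₀ C₀ : Finset G)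
      (hAt : IsImpureBeatAt H A₀ B₀ C₀) (hs : Similar (A₀, B₀, C₀) (A, B, C))
      [Fintype ↥hH.toAddSubgroup]
      (hnext : KempermanChain (toSub hH.toAddSubgroup A₀) (toSub hH.toAddSubgroup (B₀ ∩ H))
        (toSub hH.toAddSubgroup (C₀ ∩ H))) : KempermanChain A B C
  | impureChord {G : Type u} [AddCommGroup G] [Fintype G] [DecidableEq G] {A B C : Finset G}
      (H : Finset G) (hH : IsSubgroupCarrier H) (hHu : H ≠ univ) (r : G) (A₀ B₀ C₀ : Finset G)
      (hAt : IsImpureChordAt H r A₀ B₀ C₀) (hs : Similar (A₀, B₀, C₀) (A, B, C))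
      [Fintype ↥hH.toAddSubgroup]
      (hnext : KempermanChain (toSub hH.toAddSubgroup (A₀ ∩ H)) (toSub hH.toAddSubgroup (B₀ ∩ H))
        (toSub hH.toAddSubgroup (C₀ ∩ H))) : KempermanChain A B C

/-- **Theorem 4.5 (Kemperman), as printed**: "Let `Υ₁` be a maximal nontrivial critical trio in
`G₁`.  Then there exists a sequence of trios `Υ₁, Υ₂, ⋯, Υ_m` in respective subgroups
`G₁ > G₂ > ⋯ > G_m` satisfying (1) `Υ_i` is an impure beat or an impure chord with continuation
`Υ_{i+1}` for `1 ≤ i ≤ m − 1`, and (2) `Υ_m` is either a pure beat or a pure chord" — for finite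
abelian groups, by iterating `kemperman_structure_step` on the continuations.
[cite: BoothbyDevosMontejano2013, Thm 4.5] -/
theorem kemperman_structure_chain {G : Type u} [AddCommGroup G] [Fintype G] [DecidableEq G]
    {A B C : Finset G} (hmax : IsMaximalTrio A B C) (hδ : 0 < trioDeficiency A B C)
    (hA : A.Nonempty) (hB : B.Nonempty) (hC : C.Nonempty) : KempermanChain A B C := by
  suffices key : ∀ (n : ℕ) (G : Type u) [AddCommGroup G] [Fintype G] [DecidableEq G],
      Fintype.card G = n → ∀ (A B C : Finset G), IsMaximalTrio A B C → 0 < trioDeficiency A B C →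
      A.Nonempty → B.Nonempty → C.Nonempty → KempermanChain A B C from
    key _ G rfl A B C hmax hδ hA hB hC
  intro n
  induction n using Nat.strong_induction_on with
  | _ n ihn => ?_
  intro G _ _ _ hcard A B C hmax hδ hA hB hC
  obtain ⟨H, hH, hHu, hstr⟩ := kemperman_structure_step hmax hδ hA hB hC
  -- the subgroup type
  classical
  let H' := hH.toAddSubgroup
  haveI : Fintype ↥H' := Fintype.ofFinite _
  have hHH' : ∀ x, x ∈ H' ↔ x ∈ H := fun x => hH.mem_toAddSubgroup
  have hcardH : Fintype.card ↥H' = #H := by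
    have hHu' : toSub H' H = univ := eq_univ_of_forall fun x => mem_toSub.2 ((hHH' x).1 x.2)
    rw [← card_univ, ← hHu', card_toSub (fun y hy => (hHH' y).2 (mem_coe.1 hy))]
  have hlt : Fintype.card ↥H' < n := by
    rw [hcardH, ← hcard, ← card_univ]
    exact card_lt_card (ssubset_of_subset_of_ne (subset_univ H) hHu)
  rcases hstr with h | h | h | h
  · exact KempermanChain.pure H hH hHu (Or.inl h)
  · exact KempermanChain.pure H hH hHu (Or.inr h)
  · obtain ⟨A₀, B₀, C₀, hs, hAt, hmaxIn, hA₀, hB₀, hC₀, hδIn⟩ := h.exists_continuation hH hmax hA hB hC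
    have hsubs := hmaxIn
    obtain ⟨hXH, hYH, hZH, -, -⟩ := hsubs
    have cv : ∀ {W : Finset G}, W ⊆ H → (W : Set G) ⊆ H' :=
      fun hW y hy => (hHH' y).2 (hW (mem_coe.1 hy))
    refine KempermanChain.impureBeat H hH hHu A₀ B₀ C₀ hAt hs ?_
    refine ihn _ hlt (↥H') rfl _ _ _ (isMaximalTrio_toSub hHH' hmaxIn) ?_ (toSub_nonempty (cv hXH) hA₀)
      (toSub_nonempty (cv hYH) hB₀) (toSub_nonempty (cv hZH) hC₀)
    rw [trioDeficiency_toSub hHH' hXH hYH hZH, hδIn]; exact hδ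
  · obtain ⟨r, A₀, B₀, C₀, hs, hAt, hmaxIn, hA₀, hB₀, hC₀, hδIn⟩ := h.exists_continuation hH hmax
    have hsubs := hmaxIn
    obtain ⟨hXH, hYH, hZH, -, -⟩ := hsubs
    have cv : ∀ {W : Finset G}, W ⊆ H → (W : Set G) ⊆ H' :=
      fun hW y hy => (hHH' y).2 (hW (mem_coe.1 hy))
    refine KempermanChain.impureChord H hH hHu r A₀ B₀ C₀ hAt hs ?_
    refine ihn _ hlt (↥H') rfl _ _ _ (isMaximalTrio_toSub hHH' hmaxIn) ?_ (toSub_nonempty (cv hXH) hA₀)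
      (toSub_nonempty (cv hYH) hB₀) (toSub_nonempty (cv hZH) hC₀)
    rw [trioDeficiency_toSub hHH' hXH hYH hZH, hδIn]; exact hδ

end Chain

/-! ## Entry point for critical pairs -/

section CriticalPair

variable {G : Type*} [AddCommGroup G] [Fintype G] [DecidableEq G] {A B : Finset G}

/-- **Kemperman's theorem for a critical pair** (the form in which the structure theorem is used:
Proposition 2.2 + Theorem 3.5 + Theorem 4.5).  If `A, B ≠ ∅`, `|A + B| < |A| + |B|` and
`A + B ≠ G`, put `H₀ := stab(A + B)`, `A* := A + H₀ ⊇ A`, `B* := B + H₀ ⊇ B` (so `A* + B* = A + B`,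
and `|A* ∖ A| + |B* ∖ B| < |H₀|` by Kneser, `critical_iff_exists_pure_superpair`): then the maximal
nontrivial critical trio `(A*, B*, \overline{−(A+B)})` is a pure beat, a pure chord, an impure beat
or an impure chord relative to some proper subgroup `H`.
[cite: BoothbyDevosMontejano2013, Thm 4.5; Prop 2.2; Thm 3.5] -/
theorem kemperman_critical_pair (hA : A.Nonempty) (hB : B.Nonempty) (hcrit : #(A + B) < #A + #B)
    (hABu : A + B ≠ univ) :
    ∃ H : Finset G, IsSubgroupCarrier H ∧ H ≠ univ ∧
      (IsPureBeat H (A + (A + B).addStab, B + (A + B).addStab, third A B) ∨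
        IsPureChord H (A + (A + B).addStab, B + (A + B).addStab, third A B) ∨
        IsImpureBeat H (A + (A + B).addStab, B + (A + B).addStab, third A B) ∨
        IsImpureChord H (A + (A + B).addStab, B + (A + B).addStab, third A B)) := by
  have hsum := add_addStab_add_add_addStab A B
  have hA' : (A + (A + B).addStab).Nonempty := hA.add (hA.add hB).addStab
  have hB' : (B + (A + B).addStab).Nonempty := hB.add (hA.add hB).addStab
  have hthird : third A B = third (A + (A + B).addStab) (B + (A + B).addStab) := by
    rw [third, third, hsum]
  have hcrit' : #((A + (A + B).addStab) + (B + (A + B).addStab)) <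
      #(A + (A + B).addStab) + #(B + (A + B).addStab) := by
    rw [hsum]
    have h1 : #A ≤ #(A + (A + B).addStab) := card_le_card_add_right (hA.add hB).addStab
    have h2 : #B ≤ #(B + (A + B).addStab) := card_le_card_add_right (hA.add hB).addStab
    omega
  obtain ⟨hmax, hδ⟩ := (purePair_critical_iff_maximalTrio hA' hB').1
    ⟨isPurePair_add_addStab hA hB, hcrit', hthird⟩
  have hC : (third A B).Nonempty := by
    rw [hthird, ← card_pos, card_third, hsum]
    have : #(A + B) < Fintype.card G := by
      rw [← card_univ]; exact card_lt_card (ssubset_of_subset_of_ne (subset_univ _) hABu)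
    omega
  exact kemperman_structure_step hmax hδ hA' hB' hC

end CriticalPair

end Literature.Combinatorics.Additive
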